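import Summits.BirchSwinnertonDyer.BirchSwinnertonDyer.Theorems.LambdaTransportDoorAtTwoLayerTwoAlgebra
import Summits.BirchSwinnertonDyer.BirchSwinnertonDyer.Theorems.TwoAdicConverseFullTwoTorsionRamifiedUnique
import HarnessLib

/-!
# Cell bsd-rank2 (p2 GEN 61, part 2c): the MODULE ALGEBRA of the tower — under the budget `λ ≤ 4`, `rank X/TX ≥ 2`
# there is no `ν_k`-torsion for `k ≥ 3` (`ν_k = (1+T)^{2^{k-1}} + 1`), so `rank X/ω_nX` is constant for `n ≥ 2`

Cell-side file (cell bsd-rank2, HOME `run/shared/lean/pub/bsd-rank2/`, seat bsd-rank2-p2 GEN 61; memo `p2/g61/GEN61.md` §6b/§8;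
namespace `Summit.BirchSwinnertonDyer.BirchSwinnertonDyer.Theorems.LambdaTransportDoorAtTwoTowerAlgebra`). THEOREMS ONLY
(no definition, no named fact, no instance, no `sorry`); pure algebra, no elliptic curve. Sequel of part 2a
`…LayerTwoAlgebra`; consumed by part 2d `…Theorems.LambdaTransportDoorAtTwoTower` (stabilisation of the Selmer corank of
every member of the 8-15-17 family from the second layer of the cyclotomic `ℤ_2`-tower on; the residual-row dichotomy).

THE POINT (the COMPLETENESS half of memo §6b). `ω_n = (1+T)^{2^n} − 1 = ω_{n−1} · ν_n` with `ν_n = (1+T)^{2^{n−1}} + 1`, and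
for `n ≥ 3`, `ν_n = C_n^4 + 1` with `C_n = (1+T)^{2^{n−3}}`. On `V = ℚ_p ⊗ X` with `dim V ≤ 4`, `dim ker T ≥ 2`: `W = ker ν_n(T)`
meets `ker T` trivially (`ν_n ≡ 2` there) so `dim W ≤ 2`, `W` is `C_n`-stable and `C_n^4 = −1` on `W`; but an endomorphism of a
space of dimension `≤ 2` with `C^4 = −1` forces one of `−1`, `2`, `−2` to be a square in the field (`c^4 = −1` on a line;
on a plane `C² = a + bC` and `C⁴ = −1` give `b = 0, a² = −1` or `a = ±1, b² = ∓2`) — impossible in `ℚ_2`. Hence `W = 0`: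
no member of the budget class has `ν_n`-torsion for `n ≥ 3`, and `rank X/ω_nX = rank X/ω_2X` for all `n ≥ 2`.

* §1 `eq_bot_of_pow_four_eq_neg` (no `C` with `C⁴ = −1` on a `C`-stable subspace of dimension `≤ 2` when `−1, 2, −2` are
  non-squares), `ker_pow_four_add_one_eq_bot` (`ker (C⁴ + 1) = 0` under `dim V ≤ 4`, `dim ker A ≥ 2`, `C = 1` on `ker A`, `2 ≠ 0`).
* §2 `±2`, `−1` are not squares in `ℚ_2` (`padicTwo_mul_self_ne_two`, `…_ne_neg_two`, `…_ne_neg_one`; valuation parity, part 2a,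
  and `…TwoAdicTwistConverse.norm_two_padic_two`).
* §3 `lambdaInvariant_quotient_pow_four_add_one_eq_zero`: for a finitely generated torsion `Λ = ℤ_p⟦T⟧`-module `X` with
  `λ(X) ≤ 4`, `rank_{ℤ_p} X/TX ≥ 2` (and `−1, ±2` non-squares in `ℚ_p`, e.g. `p = 2`): `rank_{ℤ_p} X/(((1+T)^m)^4 + 1)X = 0` for
  every `m`; `lambdaInvariant_quotient_omega_eq_layer_two`: `rank_{ℤ_p} X/((1+T)^{2^n} − 1)X = rank_{ℤ_p} X/((1+T)^4 − 1)X` for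
  all `n ≥ 2`.

B1 honesty (director-bsd 2026-08-27): module algebra only; BSD is not touched; S0 does not move. PARTITION: none (algebra for
the r_an ≥ 2 cell, summit axis S0); TWIN (D-0056): n/a.

References: L. Washington, GTM 83 (1997) §13.1–13.3 (`ω_n`, `ν_n`, Prop. 13.8, Thm. 13.12, Lemma 13.14) [Washington1997];
R. Greenberg, LNM 1716 (1999) Thm. 1.2, Thm. 1.9, §1 p. 65 [GreenbergLNM1716]; B. Mazur, Invent. Math. 18 (1972) §6 [Mazur1972].
-/

set_option linter.dupNamespace false

noncomputable section

open scoped MatrixGroups ModularForm TensorProduct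
open PowerSeries CongruenceSubgroup WeierstrassCurve Literature.NumberTheory.EllipticCurves
  Literature.NumberTheory.EllipticCurves.ModularForms
  Literature.NumberTheory.EllipticCurves.IwasawaAlgebra
  Literature.NumberTheory.EllipticCurves.Rank1Residual
  Literature.NumberTheory.EllipticCurves.Rank1Residual.Typed
  Literature.NumberTheory.EllipticCurves.Greenberg1999

universe u

namespace Summit.BirchSwinnertonDyer.BirchSwinnertonDyer.Theorems.LambdaTransportDoorAtTwoTowerAlgebra

open Summit.BirchSwinnertonDyer.Rank2 Summit.BirchSwinnertonDyer.Rank2.Family81517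
  Summit.BirchSwinnertonDyer.Rank2.LambdaTransportDoor
  Summit.BirchSwinnertonDyer.BirchSwinnertonDyer.Theorems.LambdaTransportDoorAtTwoLayerOne
  Summit.BirchSwinnertonDyer.BirchSwinnertonDyer.Theorems.LambdaTransportDoorAtTwoLayerTwoAlgebra

/-! ### §1. No fourth root of `−1` in dimension `≤ 2` -/

section LinearAlgebra
variable {K V : Type*} [Field K] [AddCommGroup V] [Module K V] [FiniteDimensional K V]

/-- **No fourth root of `−1` in dimension `≤ 2`.** `K` a field in which `−1`, `2`, `−2` are not squares; `C` an endomorphism of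
`V`, `W` a `C`-stable subspace with `dim W ≤ 2` and `C⁴ = −1` on `W`. Then `W = 0`: for `w ≠ 0`, either `C w = c w` and
`c⁴ = −1` (so `(c²)² = −1`), or `W = ⟨w, Cw⟩`, `C² w = a w + b C w`, and `C⁴ w = −w` reads `a(a + b²) = −1`, `b(2a + b²) = 0`,
whence `b = 0, a² = −1` or `a = 1, b² = −2` or `a = −1, b² = 2`. [cite: Washington1997, §13.2 (Thm. 13.12)] [folklore] -/
theorem eq_bot_of_pow_four_eq_neg (h1 : ∀ c : K, c * c ≠ -1) (h2 : ∀ c : K, c * c ≠ 2)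
    (h3 : ∀ c : K, c * c ≠ -2) (C : Module.End K V) (W : Submodule K V) (hCW : ∀ w ∈ W, C w ∈ W)
    (hdim : Module.finrank K W ≤ 2) (hC : ∀ w ∈ W, C (C (C (C w))) = -w) : W = ⊥ := by
  by_contra hne
  obtain ⟨w, hwW, hw0⟩ := (Submodule.ne_bot_iff W).mp hne
  have hC4 := hC w hwW
  by_cases hli : LinearIndependent K ![w, C w]
  · -- `W = span {w, C w}`, `C² w = a w + b C w`, and `C⁴ w = -w` pins `(a, b)` to an impossible pair
    have hspan : Submodule.span K (Set.range ![w, C w]) ≤ W := by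
      rw [Submodule.span_le]
      rintro _ ⟨i, rfl⟩
      fin_cases i
      · exact hwW
      · exact hCW w hwW
    have hrk : Module.finrank K (Submodule.span K (Set.range ![w, C w])) = 2 := by
      rw [finrank_span_eq_card hli, Fintype.card_fin]
    have hWeq : Submodule.span K (Set.range ![w, C w]) = W :=
      Submodule.eq_of_le_of_finrank_le hspan (by rw [hrk]; exact hdim)
    have hC2mem : C (C w) ∈ Submodule.span K (Set.range ![w, C w]) := by
      rw [hWeq]; exact hCW _ (hCW w hwW)
    obtain ⟨f, hf⟩ := (Submodule.mem_span_range_iff_exists_fun K).mp hC2mem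
    simp only [Fin.sum_univ_two, Matrix.cons_val_zero, Matrix.cons_val_one, Matrix.cons_val_fin_one] at hf
    set a := f 0 with ha
    set b := f 1 with hb
    -- hf : a • w + b • C w = C (C w)
    have e3 : C (C (C w)) = (b * a) • w + (a + b * b) • C w := by
      rw [← hf, map_add, map_smul, map_smul, ← hf]
      module
    have e4 : C (C (C (C w))) = ((a + b * b) * a) • w + (b * a + (a + b * b) * b) • C w := by
      rw [e3, map_add, map_smul, map_smul, ← hf]
      module
    have key : ((a + b * b) * a + 1) • w + (b * a + (a + b * b) * b) • C w = 0 := by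
      have := hC4
      rw [e4] at this
      calc ((a + b * b) * a + 1) • w + (b * a + (a + b * b) * b) • C w
          = (((a + b * b) * a) • w + (b * a + (a + b * b) * b) • C w) + w := by module
        _ = 0 := by rw [this, neg_add_cancel]
    obtain ⟨e1, e2⟩ := LinearIndependent.pair_iff.mp hli _ _ key
    rcases mul_eq_zero.mp (show b * (2 * a + b * b) = 0 by linear_combination e2) with hb0 | hb0
    · exact h1 a (by rw [hb0] at e1; linear_combination e1)
    · have haa : a * a = 1 := by linear_combination (-1 : K) * e1 + a * hb0
      rcases mul_eq_zero.mp (show (a - 1) * (a + 1) = 0 by linear_combination haa) with ha1 | ha1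
      · exact h3 b (by linear_combination hb0 - 2 * ha1)
      · exact h2 b (by linear_combination hb0 - 2 * ha1)
  · -- `C w = c w`, then `c⁴ = -1`
    rw [LinearIndependent.pair_iff] at hli
    push Not at hli
    obtain ⟨s, t, hst, hne⟩ := hli
    have ht : t ≠ 0 := by
      rintro rfl
      rw [zero_smul, add_zero] at hst
      exact hne ((smul_eq_zero.mp hst).resolve_right hw0) rfl
    have hCw : C w = (-s / t) • w := by
      have : t • C w = -(s • w) := eq_neg_of_add_eq_zero_right hst
      calc C w = t⁻¹ • (t • C w) := by rw [smul_smul, inv_mul_cancel₀ ht, one_smul]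
        _ = (-s / t) • w := by rw [this, smul_neg, smul_smul, ← neg_smul, neg_div, div_eq_inv_mul]
    set c := -s / t with hc
    have e : C (C (C (C w))) = (c ^ 4) • w := by
      simp only [hCw, map_smul, smul_smul]
      ring_nf
    rw [e] at hC4
    have h' : (c ^ 4 + 1) • w = 0 := by rw [add_smul, one_smul, hC4, neg_add_cancel]
    have hc4 : c ^ 4 + 1 = 0 := (smul_eq_zero.mp h').resolve_right hw0
    exact h1 (c * c) (by linear_combination hc4)

omit [FiniteDimensional K V] in
/-- `(1 + A)^m v = v` when `A v = 0`. [folklore] [cite: Washington1997, §13.2] -/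
theorem pow_one_add_apply_of_apply_eq_zero (A : Module.End K V) {v : V} (hv : A v = 0) (m : ℕ) :
    ((1 + A) ^ m) v = v := by
  induction m with
  | zero => rw [pow_zero, Module.End.one_apply]
  | succ m ih => rw [pow_succ, Module.End.mul_apply, LinearMap.add_apply, Module.End.one_apply, hv, add_zero, ih]

/-- **`ker (C⁴ + 1) = 0` under the budget.** `K` with `2 ≠ 0` and `−1, 2, −2` non-squares; endomorphisms `A`, `C`,
`N = C⁴ + 1` (pointwise) of `V` with `dim V ≤ 4`, `dim ker A ≥ 2`, `C = 1` on `ker A`. Then `ker N = 0`: `W = ker N` is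
`C`-stable, `W ∩ ker A = 0` (`N = 2` there), so `dim W ≤ 2`, and §1 applies. With `A = T`, `C = (1+T)^{2^{k−3}}`, `N = ν_k(T)`
(`k ≥ 3`) this is "no `ν_k`-torsion". [cite: Washington1997, §13.2–13.3] [cite: GreenbergLNM1716, §1 p. 65] -/
theorem ker_pow_four_add_one_eq_bot (h2K : (2 : K) ≠ 0) (h1 : ∀ c : K, c * c ≠ -1) (h2 : ∀ c : K, c * c ≠ 2)
    (h3 : ∀ c : K, c * c ≠ -2) (A C N : Module.End K V) (hN : ∀ v, N v = C (C (C (C v))) + v)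
    (hC1 : ∀ v, A v = 0 → C v = v) (hV : Module.finrank K V ≤ 4)
    (hkerA : 2 ≤ Module.finrank K (LinearMap.ker A)) : LinearMap.ker N = ⊥ := by
  set W := LinearMap.ker N with hWdef
  have hCW : ∀ w ∈ W, C w ∈ W := fun w hw ↦ by
    rw [hWdef, LinearMap.mem_ker] at hw ⊢
    rw [hN] at hw ⊢
    have : C (C (C (C (C w))) + w) = 0 := by rw [hw, map_zero]
    simpa only [map_add] using this
  have hdisj : LinearMap.ker A ⊓ W = ⊥ := by
    rw [Submodule.eq_bot_iff]
    intro u hu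
    obtain ⟨huA, huW⟩ := Submodule.mem_inf.mp hu
    rw [LinearMap.mem_ker] at huA
    have hCu := hC1 u huA
    rw [hWdef, LinearMap.mem_ker, hN, hCu, hCu, hCu, hCu, ← two_smul K] at huW
    exact (smul_eq_zero.mp huW).resolve_left h2K
  have hdim : Module.finrank K W ≤ 2 := by
    have hsup := Submodule.finrank_sup_add_finrank_inf_eq (LinearMap.ker A) W
    rw [hdisj, finrank_bot, add_zero] at hsup
    have hle : Module.finrank K ↥(LinearMap.ker A ⊔ W) ≤ Module.finrank K V := Submodule.finrank_le _
    omega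
  have hC4 : ∀ w ∈ W, C (C (C (C w))) = -w := fun w hw ↦ by
    rw [hWdef, LinearMap.mem_ker, hN] at hw
    exact eq_neg_of_add_eq_zero_left hw
  exact eq_bot_of_pow_four_eq_neg h1 h2 h3 C W hCW hdim hC4

end LinearAlgebra

/-! ### §2. `±2` are not squares in `ℚ_2` -/

/-- `‖c²‖ ≠ 1/2` in `ℚ_2` (the valuation of a square is even). [folklore] [cite: Washington1997, §13.1] -/
theorem padicTwo_norm_mul_self_ne_half (c : ℚ_[2]) : ‖c * c‖ ≠ (2 : ℝ)⁻¹ := by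
  intro h
  rcases eq_or_ne c 0 with rfl | hc
  · norm_num at h
  rw [norm_mul, Padic.norm_eq_zpow_neg_valuation hc] at h
  simp only [Nat.cast_ofNat] at h
  rw [← zpow_add₀ (by norm_num : (2 : ℝ) ≠ 0), ← zpow_neg_one] at h
  have := zpow_right_injective₀ (by norm_num : (0 : ℝ) < 2) (by norm_num : (2 : ℝ) ≠ 1) h
  omega

/-- **`2` is not a square in `ℚ_2`.** [folklore] [cite: Washington1997, §13.1] -/
theorem padicTwo_mul_self_ne_two (c : ℚ_[2]) : c * c ≠ 2 := fun h ↦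
  padicTwo_norm_mul_self_ne_half c (by rw [h, TwoAdicTwistConverse.norm_two_padic_two])

/-- **`−2` is not a square in `ℚ_2`.** [folklore] [cite: Washington1997, §13.1] -/
theorem padicTwo_mul_self_ne_neg_two (c : ℚ_[2]) : c * c ≠ -2 := fun h ↦
  padicTwo_norm_mul_self_ne_half c (by rw [h, norm_neg, TwoAdicTwistConverse.norm_two_padic_two])

/-- **`−1` is not a square in `ℚ_2`** (`c·c` form of part 2a `padicTwo_sq_ne_neg_one`). [folklore] [cite: Washington1997, §13.1] -/
theorem padicTwo_mul_self_ne_neg_one (c : ℚ_[2]) : c * c ≠ -1 := fun h ↦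
  padicTwo_sq_ne_neg_one c (by rw [sq, h])

/-! ### §3. Module level: no `ν_k`-torsion for `k ≥ 3`, and the tower stabilises at layer `2` -/

section Module3

variable {p : ℕ} [Fact p.Prime] {M : Type u} [AddCommGroup M] [Module (IwasawaAlgebra p) M]
  [Module.Finite (IwasawaAlgebra p) M]

/-- **NO `ν_k`-TORSION UNDER THE BUDGET (module form).** `Λ = ℤ_p⟦T⟧` with `−1, 2, −2` non-squares in `ℚ_p` (e.g. `p = 2`);
`X` a finitely generated torsion `Λ`-module with `λ(X) ≤ 4` and `rank_{ℤ_p} X/TX ≥ 2`. Then for every `m`,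
`rank_{ℤ_p} X/(((1+T)^m)^4 + 1)X = 0` — in particular for `ν_k = (1+T)^{2^{k−1}} + 1 = ((1+T)^{2^{k−3}})^4 + 1`, `k ≥ 3`,
the factor of `ω_k` cutting out the `k`-th layer of the `ℤ_p`-tower. (§1 on `V = ℚ_p ⊗ X` via
`…LayerOne.lambdaInvariant_quotient_eq_finrank_ker`.)
[cite: GreenbergLNM1716, Thm. 1.2, §1 p. 65] [cite: Washington1997, §13.2–13.3 (`ω_n`, `ν_n`)] -/
theorem lambdaInvariant_quotient_pow_four_add_one_eq_zero (h1 : ∀ c : ℚ_[p], c * c ≠ -1)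
    (h2 : ∀ c : ℚ_[p], c * c ≠ 2) (h3 : ∀ c : ℚ_[p], c * c ≠ -2) (hM : Module.IsTorsion (IwasawaAlgebra p) M)
    (hl : lambdaInvariant p M ≤ 4) (hT : 2 ≤ coinvariantsRank p M) (m : ℕ) :
    lambdaInvariant p (M ⧸ (Ideal.span {(((1 + PowerSeries.X) ^ m) ^ 4 + 1 : IwasawaAlgebra p)} •
      (⊤ : Submodule (IwasawaAlgebra p) M))) = 0 := by
  letI : Module ℤ_[p] M := Module.compHom M (algebraMap ℤ_[p] (IwasawaAlgebra p))
  haveI : IsScalarTower ℤ_[p] (IwasawaAlgebra p) M := IsScalarTower.of_compHom ℤ_[p] _ _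
  haveI : Module.Flat ℤ_[p] ℚ_[p] := IsLocalization.flat ℚ_[p] (nonZeroDivisors ℤ_[p])
  haveI : Module.Finite ℚ_[p] (ℚ_[p] ⊗[ℤ_[p]] M) := finite_baseChange_of_isTorsion p hM
  let L : IwasawaAlgebra p → (M →ₗ[ℤ_[p]] M) := fun a ↦
    (DistribSMul.toLinearMap (IwasawaAlgebra p) M a).restrictScalars ℤ_[p]
  have hLmul : ∀ a b : IwasawaAlgebra p, L (a * b) = L a * L b := fun a b ↦ by
    ext x
    change (a * b) • x = a • b • x
    rw [mul_smul]
  have hLadd : ∀ a b : IwasawaAlgebra p, L (a + b) = L a + L b := fun a b ↦ by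
    ext x
    change (a + b) • x = a • x + b • x
    rw [add_smul]
  have hLone : L 1 = 1 := by
    ext x
    change (1 : IwasawaAlgebra p) • x = x
    rw [one_smul]
  have hLpow : ∀ (a : IwasawaAlgebra p) (k : ℕ), L (a ^ k) = L a ^ k := fun a k ↦ by
    induction k with
    | zero => rw [pow_zero, pow_zero, hLone]
    | succ k ih => rw [pow_succ, pow_succ, hLmul, ih]
  have hbcpow : ∀ (f : M →ₗ[ℤ_[p]] M) (k : ℕ), (f ^ k).baseChange ℚ_[p] = f.baseChange ℚ_[p] ^ k := fun f k ↦ by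
    induction k with
    | zero => rw [pow_zero, pow_zero, LinearMap.baseChange_one]
    | succ k ih => rw [pow_succ, pow_succ, LinearMap.baseChange_mul, ih]
  set A : Module.End ℚ_[p] (ℚ_[p] ⊗[ℤ_[p]] M) := (L PowerSeries.X).baseChange ℚ_[p] with hA
  set C : Module.End ℚ_[p] (ℚ_[p] ⊗[ℤ_[p]] M) := (L ((1 + PowerSeries.X) ^ m)).baseChange ℚ_[p] with hCdef
  have hC : C = (1 + A) ^ m := by
    rw [hCdef, hLpow, hbcpow, hLadd, hLone, LinearMap.baseChange_add, LinearMap.baseChange_one]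
  set N : Module.End ℚ_[p] (ℚ_[p] ⊗[ℤ_[p]] M) :=
    (L ((((1 + PowerSeries.X) ^ m) ^ 4 + 1))).baseChange ℚ_[p] with hNdef
  have hNC : N = C ^ 4 + 1 := by
    rw [hNdef, hLadd, hLone, hLpow, LinearMap.baseChange_add, LinearMap.baseChange_one, hbcpow]
  have hN : ∀ v, N v = C (C (C (C v))) + v := fun v ↦ by
    rw [hNC, LinearMap.add_apply, Module.End.one_apply]
    simp only [pow_succ, pow_zero, one_mul, Module.End.mul_apply]
  have hC1 : ∀ v, A v = 0 → C v = v := fun v hv ↦ by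
    rw [hC]
    exact pow_one_add_apply_of_apply_eq_zero A hv m
  have hV : lambdaInvariant p M = Module.finrank ℚ_[p] (ℚ_[p] ⊗[ℤ_[p]] M) := lambdaInvariant_eq_finrank_tensorProduct M
  have hT' : coinvariantsRank p M = Module.finrank ℚ_[p] (LinearMap.ker A) := by
    rw [coinvariantsRank_eq_lambdaInvariant]
    exact lambdaInvariant_quotient_eq_finrank_ker hM (PowerSeries.X : IwasawaAlgebra p)
  have hker := ker_pow_four_add_one_eq_bot two_ne_zero h1 h2 h3 A C N hN hC1 (by rw [← hV]; exact hl)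
    (by rw [← hT']; exact hT)
  have h := lambdaInvariant_quotient_eq_finrank_ker hM ((((1 + PowerSeries.X) ^ m) ^ 4 + 1 : IwasawaAlgebra p))
  change lambdaInvariant p _ = Module.finrank ℚ_[p] (LinearMap.ker N) at h
  rw [h, hker, finrank_bot]

/-- **THE TOWER STABILISES AT LAYER 2 (module form).** Under the same hypotheses, for every `n ≥ 2`:
`rank_{ℤ_p} X/ω_nX = rank_{ℤ_p} X/ω_2X`, `ω_n = (1+T)^{2^n} − 1` — induction on `n` with `ω_{n+1} = ν_{n+1} · ω_n`,
`ν_{n+1} = ((1+T)^{2^{n−2}})^4 + 1` acting injectively on `ℚ_p ⊗ X` (`lambdaInvariant_quotient_pow_four_add_one_eq_zero`), so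
`ker ω_{n+1}(T) = ker ω_n(T)`. [cite: GreenbergLNM1716, Thm. 1.2, Thm. 1.9] [cite: Washington1997, §13.3 (Lemma 13.14ff)] -/
theorem lambdaInvariant_quotient_omega_eq_layer_two (h1 : ∀ c : ℚ_[p], c * c ≠ -1)
    (h2 : ∀ c : ℚ_[p], c * c ≠ 2) (h3 : ∀ c : ℚ_[p], c * c ≠ -2) (hM : Module.IsTorsion (IwasawaAlgebra p) M)
    (hl : lambdaInvariant p M ≤ 4) (hT : 2 ≤ coinvariantsRank p M) {n : ℕ} (hn : 2 ≤ n) :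
    lambdaInvariant p (M ⧸ (Ideal.span {((1 + PowerSeries.X) ^ (2 ^ n) - 1 : IwasawaAlgebra p)} •
      (⊤ : Submodule (IwasawaAlgebra p) M))) =
    lambdaInvariant p (M ⧸ (Ideal.span {((1 + PowerSeries.X) ^ (2 ^ 2) - 1 : IwasawaAlgebra p)} •
      (⊤ : Submodule (IwasawaAlgebra p) M))) := by
  letI : Module ℤ_[p] M := Module.compHom M (algebraMap ℤ_[p] (IwasawaAlgebra p))
  haveI : IsScalarTower ℤ_[p] (IwasawaAlgebra p) M := IsScalarTower.of_compHom ℤ_[p] _ _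
  haveI : Module.Flat ℤ_[p] ℚ_[p] := IsLocalization.flat ℚ_[p] (nonZeroDivisors ℤ_[p])
  haveI : Module.Finite ℚ_[p] (ℚ_[p] ⊗[ℤ_[p]] M) := finite_baseChange_of_isTorsion p hM
  let L : IwasawaAlgebra p → (M →ₗ[ℤ_[p]] M) := fun a ↦
    (DistribSMul.toLinearMap (IwasawaAlgebra p) M a).restrictScalars ℤ_[p]
  have hLmul : ∀ a b : IwasawaAlgebra p, L (a * b) = L a * L b := fun a b ↦ by
    ext x
    change (a * b) • x = a • b • x
    rw [mul_smul]
  -- the kernel as a function of the element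
  have hk : ∀ a : IwasawaAlgebra p, lambdaInvariant p (M ⧸ (Ideal.span {a} • (⊤ : Submodule (IwasawaAlgebra p) M))) =
      Module.finrank ℚ_[p] (LinearMap.ker ((L a).baseChange ℚ_[p])) := fun a ↦
    lambdaInvariant_quotient_eq_finrank_ker hM a
  induction n, hn using Nat.le_induction with
  | base => rfl
  | succ n hn ih =>
    -- `ω_{n+1} = ν_{n+1} · ω_n` with `ν_{n+1} = ((1+T)^{2^{n-2}})^4 + 1`
    obtain ⟨k, rfl⟩ := Nat.exists_eq_add_of_le hn
    have hfac : ((1 + PowerSeries.X) ^ (2 ^ (2 + k + 1)) - 1 : IwasawaAlgebra p) =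
        ((((1 + PowerSeries.X) ^ (2 ^ k)) ^ 4 + 1) * ((1 + PowerSeries.X) ^ (2 ^ (2 + k)) - 1)) := by
      rw [← pow_mul]
      ring
    have hinj : LinearMap.ker ((L ((((1 + PowerSeries.X) ^ (2 ^ k)) ^ 4 + 1))).baseChange ℚ_[p]) = ⊥ := by
      rw [← Submodule.finrank_eq_zero, ← hk]
      exact lambdaInvariant_quotient_pow_four_add_one_eq_zero h1 h2 h3 hM hl hT (2 ^ k)
    rw [← ih, hk, hk, hfac, hLmul, LinearMap.baseChange_mul, Module.End.mul_eq_comp,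
      LinearMap.ker_comp_of_ker_eq_bot _ hinj]

end Module3

end Summit.BirchSwinnertonDyer.BirchSwinnertonDyer.Theorems.LambdaTransportDoorAtTwoTowerAlgebra
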